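import Summits.ABC.ABC.Theorems.IsogenyGlueCongruenceMazurKenkuBoundStubTwoChainAlgebra
import Summits.ABC.ABC.Theorems.IsogenyGlueCongruenceMazurKenkuBoundStubTwoVertex
import Summits.ABC.ABC.Theorems.IsogenyGlueCongruenceMazurKenkuBoundStubTwoNormalize
import Summits.ABC.ABC.Theorems.IsogenyGlueCongruenceMazurKenkuBoundStubTwoStep
import HarnessLib

/-!
# Crux `MazurKenkuBound` (stmt-ABC-15125), line `radius-lite` — Kenku's level `32` without
# modular curves: no cyclic `ℚ`-isogeny of degree `32`

One of the eight radius-minimal direct levels of the Mazur–Kenku reduction (`X₀(32)`, genus one,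
rank zero, rational points = cusps: Ligozat 1975; Kenku 1982, proof of Thm. 1). This file
assembles a modular-curve-free proof from the four landed stubs of the level-`32` two-chain of
lead c21 (idea card `fermat-quartic-two-part`, crux stmt-ABC-15192):

* `stub_twoNormalize` (p141542): a cyclic `ℚ`-isogeny of degree `2ᵏ` yields a `Γ_ℚ`-stable cyclic
  subgroup of order `2ᵏ` on a model `y² = x³ + ax² + bx` whose element of order `2` is `(0,0)`;
* `stub_twoVertex` (p141021): for `k ≥ 2` this forces `b = d²` (duplication formula + descent);
* `stub_twoStep` (p141564): Silverman's `2`-isogeny carries the datum to order `2ᵏ⁻¹` on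
  `y² = x³ + (a + 6e)x² + 4e(a + 2e)x`, `e = ±d`;
* `stub_twoChainAlgebra` (p140195): the three vertex relations of a chain `32 → 16 → 8 → 4` force
  a rational point with `Y ≠ 0` on `Y² = X³ − X`, against Fermat
  (`MestreOesterle.eq_zero_of_sq_eq_cube_sub_self`).

## References

* [Kenku1982] M. A. Kenku, J. Number Theory 15 (1982) 199–202, proof of Thm. 1, p. 201.
* [Ligozat1975] G. Ligozat, *Courbes modulaires de genre 1*, Mém. SMF 43 (1975).
* [SilvermanAEC2009] J. H. Silverman, *The Arithmetic of Elliptic Curves*, 2nd ed., III.4 Ex. 4.5.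
* [Knapp1993] A. W. Knapp, *Elliptic Curves*, Princeton 1993, Cor. 4.22 (Fermat's `y² = x³ − x`).
-/

-- `Summit.ABC.ABC` is the mandated summit-side namespace (CONVENTIONS §2); the duplicate is deliberate.
set_option linter.dupNamespace false

noncomputable section

open scoped Classical
open WeierstrassCurve
open Literature.NumberTheory.EllipticCurves

namespace Summit.ABC.ABC.Theorems

/-- Transport of the chain data along an equality of the coefficient `b` (bookkeeping). [folklore] -/
theorem levelThirtyTwo_transport {a b b' : ℚ} (h : b = b') {k : ℕ}
    (H : ∃ (_ : (⟨0, a, 0, b, 0⟩ : WeierstrassCurve ℚ).IsElliptic)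
      (C : AddSubgroup (⟨0, a, 0, b, 0⟩ : WeierstrassCurve ℚ).geomPoints),
      (∀ σ : Field.absoluteGaloisGroup ℚ, ∀ P ∈ C, σ • P ∈ C) ∧ IsAddCyclic C ∧
        Nat.card C = 2 ^ k ∧
        ∀ P ∈ C, 2 • P = 0 → P ≠ 0 →
          P = (⟨0, a, 0, b, 0⟩ : WeierstrassCurve ℚ).geomTwoTorsionPoint) :
    ∃ (_ : (⟨0, a, 0, b', 0⟩ : WeierstrassCurve ℚ).IsElliptic)
      (C : AddSubgroup (⟨0, a, 0, b', 0⟩ : WeierstrassCurve ℚ).geomPoints),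
      (∀ σ : Field.absoluteGaloisGroup ℚ, ∀ P ∈ C, σ • P ∈ C) ∧ IsAddCyclic C ∧
        Nat.card C = 2 ^ k ∧
        ∀ P ∈ C, 2 • P = 0 → P ≠ 0 →
          P = (⟨0, a, 0, b', 0⟩ : WeierstrassCurve ℚ).geomTwoTorsionPoint := by
  subst h
  exact H

/-- One level of the chain, vertex included: from the chain data of order `2ᵏ`, `k ≥ 3`, on
`y² = x³ + ax² + d²x`, the chain data of order `2ᵏ⁻¹` on `y² = x³ + (a + 6e)x² + d'²x` with
`e = ±d` and `d'² = 4e(a + 2e)` (stubs 10 and 9 and the transport). [folklore] -/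
theorem levelThirtyTwo_step {a d : ℚ} {k : ℕ} (hk : 3 ≤ k)
    (H : ∃ (_ : (⟨0, a, 0, d ^ 2, 0⟩ : WeierstrassCurve ℚ).IsElliptic)
      (C : AddSubgroup (⟨0, a, 0, d ^ 2, 0⟩ : WeierstrassCurve ℚ).geomPoints),
      (∀ σ : Field.absoluteGaloisGroup ℚ, ∀ P ∈ C, σ • P ∈ C) ∧ IsAddCyclic C ∧
        Nat.card C = 2 ^ k ∧
        ∀ P ∈ C, 2 • P = 0 → P ≠ 0 →
          P = (⟨0, a, 0, d ^ 2, 0⟩ : WeierstrassCurve ℚ).geomTwoTorsionPoint) :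
    ∃ e d' : ℚ, (e = d ∨ e = -d) ∧ d' ^ 2 = 4 * e * (a + 2 * e) ∧
      ∃ (_ : (⟨0, a + 6 * e, 0, d' ^ 2, 0⟩ : WeierstrassCurve ℚ).IsElliptic)
        (C : AddSubgroup (⟨0, a + 6 * e, 0, d' ^ 2, 0⟩ : WeierstrassCurve ℚ).geomPoints),
        (∀ σ : Field.absoluteGaloisGroup ℚ, ∀ P ∈ C, σ • P ∈ C) ∧ IsAddCyclic C ∧
          Nat.card C = 2 ^ (k - 1) ∧
          ∀ P ∈ C, 2 • P = 0 → P ≠ 0 →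
            P = (⟨0, a + 6 * e, 0, d' ^ 2, 0⟩ : WeierstrassCurve ℚ).geomTwoTorsionPoint := by
  obtain ⟨hE, C, hst, hcyc, hcard, h2⟩ := H
  obtain ⟨e, he, hE', C', hst', hcyc', hcard', h2'⟩ :=
    stub_twoStep a d C k (by omega) hst hcyc hcard h2
  haveI := hE'
  obtain ⟨d', hd'⟩ :=
    stub_twoVertex (a + 6 * e) (4 * e * (a + 2 * e)) C' (k - 1) (by omega) hst' hcyc' hcard' h2'
  exact ⟨e, d', he, hd'.symm, levelThirtyTwo_transport hd' ⟨hE', C', hst', hcyc', hcard', h2'⟩⟩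

/-- Nondegeneracy of one level: `y² = x³ + Ax² + Bx` elliptic with `B = E²` gives `E ≠ 0` and
`A² ≠ 4E²` (`Δ = 16B²(A² − 4B)`; the tree's `a₄_ne_zero`, `a₂_sq_sub_ne_zero`). [folklore] -/
theorem levelThirtyTwo_nondeg {A B E : ℚ} [hEll : (⟨0, A, 0, B, 0⟩ : WeierstrassCurve ℚ).IsElliptic]
    (hB : B = E ^ 2) : E ≠ 0 ∧ A ^ 2 ≠ 4 * E ^ 2 := by
  have h4 := WeierstrassCurve.a₄_ne_zero (⟨0, A, 0, B, 0⟩ : WeierstrassCurve ℚ)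
  have h2 := WeierstrassCurve.a₂_sq_sub_ne_zero (⟨0, A, 0, B, 0⟩ : WeierstrassCurve ℚ)
  simp only at h4 h2
  refine ⟨?_, ?_⟩
  · rintro rfl
    exact h4 (by rw [hB]; ring)
  · intro h
    exact h2 (by rw [hB, h]; ring)

/-- **No cyclic `ℚ`-isogeny of degree `32`** (Kenku's level `32`, `Y₀(32)(ℚ) = ∅` — Ligozat
1975 / Kenku 1982 — proved here WITHOUT modular curves): normalise the kernel to a chain datum of
order `32` on `y² = x³ + ax² + bx` (`stub_twoNormalize`, p141542), vertex at level `0`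
(`stub_twoVertex`, p141021), three levels down Silverman's explicit `2`-isogenies
(`stub_twoStep`, p141564; orders `32 → 16 → 8 → 4`) with the vertex criterion at each level, and
the Diophantine end on `Y² = X³ − X` by Fermat's descent (`stub_twoChainAlgebra`, p140195).
Registered stub `stub_levelThirtyTwo` of crux stmt-ABC-15125 (line `radius-lite`, lead c21);
idea card `fermat-quartic-two-part` (crux stmt-ABC-15192).
[cite: Kenku1982, proof of Thm. 1, p. 201] [cite: Knapp1993, Cor. 4.22]
[cite: SilvermanAEC2009, III.4 Example 4.5] -/
theorem stub_levelThirtyTwo :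
    ∀ (V V' : WeierstrassCurve ℚ) [V.IsElliptic] [V'.IsElliptic] (ψ : Isogeny V V'),
      ψ.IsCyclic → ψ.degree ≠ 32 := by
  intro V V' _ _ ψ hψ hdeg
  -- level 0: order 32 on `y² = x³ + a₀x² + b₀x`, then `b₀ = d₀²`
  obtain ⟨a₀, b₀, hE₀, C₀, hst₀, hcyc₀, hcard₀, h2₀⟩ :=
    stub_twoNormalize V V' ψ 5 (by norm_num) hψ (by rw [hdeg]; norm_num)
  haveI := hE₀
  obtain ⟨d₀, hb₀⟩ := stub_twoVertex a₀ b₀ C₀ 5 (by norm_num) hst₀ hcyc₀ hcard₀ h2₀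
  have H₀ := levelThirtyTwo_transport (k := 5) hb₀ ⟨hE₀, C₀, hst₀, hcyc₀, hcard₀, h2₀⟩
  -- levels 1, 2, 3
  obtain ⟨e₀, d₁, he₀, hd₁, H₁⟩ := levelThirtyTwo_step (k := 5) (by norm_num) H₀
  obtain ⟨e₁, d₂, he₁, hd₂, H₂⟩ := levelThirtyTwo_step (k := 4) (by norm_num) H₁
  obtain ⟨e₂, d₃, he₂, hd₃, H₃⟩ := levelThirtyTwo_step (k := 3) (by norm_num) H₂
  -- nondegeneracy at levels 0, 1, 2
  obtain ⟨hE₀', -⟩ := H₀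
  obtain ⟨hE₁', -⟩ := H₁
  obtain ⟨hE₂', -⟩ := H₂
  have n₀ := (levelThirtyTwo_nondeg (hEll := hE₀') rfl).1
  have n₁ := levelThirtyTwo_nondeg (hEll := hE₁') rfl
  have n₂ := levelThirtyTwo_nondeg (hEll := hE₂') rfl
  -- `eᵢ = ±dᵢ`: nonvanishing and the relations in terms of the `eᵢ`
  have he₀0 : e₀ ≠ 0 := by rcases he₀ with rfl | rfl <;> simp [n₀]
  have he₁0 : e₁ ≠ 0 := by rcases he₁ with rfl | rfl <;> simp [n₁.1]
  have he₂0 : e₂ ≠ 0 := by rcases he₂ with rfl | rfl <;> simp [n₂.1]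
  have hsq₁ : e₁ ^ 2 = d₁ ^ 2 := by rcases he₁ with rfl | rfl <;> ring
  have hsq₂ : e₂ ^ 2 = d₂ ^ 2 := by rcases he₂ with rfl | rfl <;> ring
  refine stub_twoChainAlgebra a₀ e₀ e₁ e₂ d₃ he₀0 he₁0 he₂0 (by rw [hsq₁, hd₁])
    (by rw [hsq₂, hd₂]) hd₃ ?_ ?_
  · rw [hsq₁]; exact n₁.2
  · rw [hsq₂]; exact n₂.2

/-- **No cyclic `ℚ`-isogeny of degree `32`** (curried corollary of `stub_levelThirtyTwo`).
[cite: Kenku1982, proof of Thm. 1, p. 201] -/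
theorem isogeny_isCyclic_degree_ne_thirtyTwo {V V' : WeierstrassCurve ℚ} [V.IsElliptic]
    [V'.IsElliptic] (ψ : Isogeny V V') (hψ : ψ.IsCyclic) : ψ.degree ≠ 32 :=
  stub_levelThirtyTwo V V' ψ hψ

end Summit.ABC.ABC.Theorems

end
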